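import Mathlib
import HarnessLib
import Literature.Probability.Percolation.HexLatticeSegments
import Literature.Probability.Percolation.OneArmLSW

/-!
# Open Voronoi hexagons of the unit triangular lattice (line `Sketch`, stub `stub_cellBridge`, 1)

Crux `Summit.CriticalPhenomena.CardyFormulaZ2.Theses.CardyMagicRigidity.MagicFormulaT`
(stmt-CriticalPhenomena-4836), line `Sketch`, stub `stub_cellBridge` of the registered skeleton
`Cruxes/MagicFormulaT/Lines/Sketch.lean`; this helper file is registered on the crux as the
sub-goal `cellBridge_hexCellsTiling` (its last theorem).  It is the planar geometry of the cells
of that stub, in tree vocabulary only (no definition; the cell is a local notation): the open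
Voronoi cell of the site `x` of the unit lattice `𝕋` is the open regular hexagon of inradius `1/2`
`H_x = {z | |hform i (z − triMeshPoint 1 x)| < 1, i = 0, 1, 2}` (`hform i = X − Y, X + 2Y, 2X + Y`
in the lattice coordinates of `TriLatticeSegments.lean`).

* hex-form algebra (`hform_add'`, `norm_sq_eq_hform : ‖z‖² = Σ μ_i²/6`,
  `exists_int_hform_triEmbed`);
* the cells are open, measurable, convex, contain their site, lie in the unit disc about it, and
  cells of distinct sites are disjoint (`disjoint_hexCell`: the integral forms of a nonzero
  lattice vector are not all in `{−1, 0, 1}`);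
* they cover `ℂ` off the null union of the integral level lines of the forms
  (`ae_exists_mem_hexCell`, by minimising the distance to `z` over the sites; `volume_hformLines`);
* charge sites: a cell meeting `B̄(0, ρ)` has its site in `triBall ⌈2(ρ + 1)⌉₊`
  (`mem_triBall_of_mem_hexCell_of_norm_le`); sites of `triBall ⌈2(R/δ + 1)⌉₊` have norm
  `≤ (2|R| + 3)/δ` for `0 < δ ≤ 1` (`norm_triMeshPoint_le_of_mem_triBall`).

That the cells miss every interface trace is `CardyMagicRigidityMagicFormulaTHexEdges.lean`.
Folklore planar geometry proved by lattice coordinates; no named facts are used.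
-/

noncomputable section

namespace Summit.CriticalPhenomena.CardyFormulaZ2.Cruxes.MagicFormulaT.LineSketch

open MeasureTheory Set Metric
open scoped Real Topology
open Literature.Probability.Percolation Literature.Probability.LatticeModels

/-- The open Voronoi hexagon of the site `x` of the unit lattice (local notation, not a definition:
the stub `stub_cellBridge` is stated with this set written inline). -/
local notation3 (prettyPrint := false) "𝓗[" x "]" =>
  {z : ℂ | ∀ i : Fin 3, |hform i (z - triMeshPoint 1 x)| < 1}

/-! ## Hex-form algebra -/

/-- The hex forms are additive. -/
theorem hform_add' (i : Fin 3) (p q : ℂ) : hform i (p + q) = hform i p + hform i q := by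
  fin_cases i <;> simp [hform, triX_add, triY_add] <;> ring

/-- The hex forms respect subtraction. -/
theorem hform_sub' (i : Fin 3) (p q : ℂ) : hform i (p - q) = hform i p - hform i q := by
  fin_cases i <;> simp [hform, triX_sub, triY_sub] <;> ring

/-- The hex forms are real-homogeneous. -/
theorem hform_real_mul (i : Fin 3) (t : ℝ) (z : ℂ) : hform i ((t : ℂ) * z) = t * hform i z := by
  fin_cases i <;> simp [hform, triX_smul, triY_smul] <;> ring

/-- The hex forms vanish at the origin. -/
theorem hform_origin (i : Fin 3) : hform i (0 : ℂ) = 0 := by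
  fin_cases i <;> simp [hform, triX, triY]

/-- The hex forms are real-linear maps. -/
theorem isLinearMap_hform (i : Fin 3) : IsLinearMap ℝ (hform i) := by
  refine ⟨fun p q ↦ hform_add' i p q, fun t z ↦ ?_⟩
  rw [Complex.real_smul, hform_real_mul, smul_eq_mul]

/-- The hex forms are continuous. -/
theorem continuous_hform (i : Fin 3) : Continuous (hform i) := by
  have hX : Continuous triX := by unfold triX; fun_prop
  have hY : Continuous triY := by unfold triY; fun_prop
  fin_cases i
  · show Continuous fun p ↦ hform 0 p
    simp only [hform_zero]; fun_prop
  · show Continuous fun p ↦ hform 1 p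
    simp only [hform_one]; fun_prop
  · show Continuous fun p ↦ hform 2 p
    simp only [hform_two]; fun_prop

/-- `‖z‖² = X² + XY + Y²` in lattice coordinates.
-- adapted from Cruxes/MagicFormulaT/Disproof.lean (`norm_sq_eq_tri`) -/
theorem norm_sq_eq_tri' (z : ℂ) : ‖z‖ ^ 2 = triX z ^ 2 + triX z * triY z + triY z ^ 2 := by
  have h3 : Real.sqrt 3 ^ 2 = 3 := Real.sq_sqrt (by norm_num)
  have hs : Real.sqrt 3 ≠ 0 := Real.sqrt_ne_zero'.2 (by norm_num)
  rw [Complex.sq_norm, Complex.normSq_apply, triX, triY]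
  field_simp
  nlinarith [h3]

/-- **`‖z‖² = (μ₀(z)² + μ₁(z)² + μ₂(z)²)/6`**: the squared norm is a sixth of the sum of the squared
hex forms. -/
theorem norm_sq_eq_hform (z : ℂ) :
    ‖z‖ ^ 2 = (hform 0 z ^ 2 + hform 1 z ^ 2 + hform 2 z ^ 2) / 6 := by
  rw [norm_sq_eq_tri', hform_zero, hform_one, hform_two]
  ring

/-- **Sites have integral hex forms** (`(a₀ − a₁, a₀ + 2a₁, 2a₀ + a₁)`). -/
theorem exists_int_hform_triEmbed (i : Fin 3) (a : Site 2) : ∃ m : ℤ, hform i (triEmbed a) = m := by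
  fin_cases i
  · exact ⟨a 0 - a 1, by simp [triX_triEmbed, triY_triEmbed]⟩
  · exact ⟨a 0 + 2 * a 1, by simp [triX_triEmbed, triY_triEmbed]⟩
  · exact ⟨2 * a 0 + a 1, by simp [triX_triEmbed, triY_triEmbed]⟩

/-! ## The open cells: topology, convexity, size, disjointness -/

/-- The open cell is open. -/
theorem isOpen_hexCell (x : Site 2) : IsOpen 𝓗[x] := by
  rw [Set.setOf_forall]
  exact isOpen_iInter_of_finite fun i ↦
    isOpen_lt (continuous_abs.comp ((continuous_hform i).comp (continuous_id.sub continuous_const)))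
      continuous_const

/-- The open cell is Lebesgue measurable. -/
theorem measurableSet_hexCell (x : Site 2) : MeasurableSet 𝓗[x] :=
  (isOpen_hexCell x).measurableSet

/-- The open cell as an intersection of six open half-planes. -/
theorem hexCell_eq_iInter (x : Site 2) :
    𝓗[x] = ⋂ i : Fin 3, ({z : ℂ | hform i z < hform i (triMeshPoint 1 x) + 1} ∩
      {z : ℂ | hform i (triMeshPoint 1 x) - 1 < hform i z}) := by
  ext z
  simp only [mem_setOf_eq, mem_iInter, mem_inter_iff, hform_sub', abs_lt]
  constructor
  · intro h i
    have := h i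
    constructor <;> linarith [this.1, this.2]
  · intro h i
    have := h i
    constructor <;> linarith [this.1, this.2]

/-- **The open cell is convex** (hence preconnected). -/
theorem convex_hexCell (x : Site 2) : Convex ℝ 𝓗[x] := by
  rw [hexCell_eq_iInter]
  exact convex_iInter fun i ↦
    (convex_halfSpace_lt (isLinearMap_hform i) _).inter
      (convex_halfSpace_gt (isLinearMap_hform i) _)

/-- The open cell is preconnected. -/
theorem isPreconnected_hexCell (x : Site 2) : IsPreconnected 𝓗[x] :=
  (convex_hexCell x).isPreconnected

/-- The site lies in its cell. -/
theorem triMeshPoint_mem_hexCell (x : Site 2) : triMeshPoint 1 x ∈ 𝓗[x] := by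
  intro i
  rw [sub_self, hform_origin, abs_zero]
  exact one_pos

/-- **A cell lies in the open unit disc about its site** (in fact in the disc of radius `1/√2`:
`‖z − x‖² = Σ μ_i² / 6 < 1/2`). -/
theorem norm_sub_lt_one_of_mem_hexCell {x : Site 2} {z : ℂ} (hz : z ∈ 𝓗[x]) :
    ‖z - triMeshPoint 1 x‖ < 1 := by
  have h0 := (sq_lt_one_iff_abs_lt_one _).2 (hz 0)
  have h1 := (sq_lt_one_iff_abs_lt_one _).2 (hz 1)
  have h2 := (sq_lt_one_iff_abs_lt_one _).2 (hz 2)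
  have hsq : ‖z - triMeshPoint 1 x‖ ^ 2 < 1 := by
    rw [norm_sq_eq_hform]; linarith
  nlinarith [norm_nonneg (z - triMeshPoint 1 x)]

/-- A cell lies in the open unit disc about its site. -/
theorem hexCell_subset_ball (x : Site 2) : 𝓗[x] ⊆ ball (triMeshPoint 1 x) 1 := fun _ hz ↦
  mem_ball_iff_norm.2 (norm_sub_lt_one_of_mem_hexCell hz)

/-- **Cells of distinct sites are disjoint**: the integral hex forms of a nonzero lattice vector
cannot all lie in `{−1, 0, 1}`. -/
theorem disjoint_hexCell {x y : Site 2} (h : x ≠ y) : Disjoint 𝓗[x] 𝓗[y] := by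
  refine Set.disjoint_left.2 fun z hz hz' ↦ h ?_
  have key : ∀ i, hform i (triEmbed y) - hform i (triEmbed x) < 2 ∧
      -2 < hform i (triEmbed y) - hform i (triEmbed x) := fun i ↦ by
    have h1 := hz i
    have h2 := hz' i
    rw [triMeshPoint_one, hform_sub', abs_lt] at h1 h2
    constructor <;> linarith [h1.1, h1.2, h2.1, h2.2]
  have k0 := key 0
  have k1 := key 1
  have k2 := key 2
  simp only [hform_zero, hform_one, hform_two, triX_triEmbed, triY_triEmbed] at k0 k1 k2
  have e0 : y 0 - y 1 - (x 0 - x 1) < 2 := by exact_mod_cast k0.1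
  have e0' : -2 < y 0 - y 1 - (x 0 - x 1) := by exact_mod_cast k0.2
  have e1 : y 0 + 2 * y 1 - (x 0 + 2 * x 1) < 2 := by exact_mod_cast k1.1
  have e1' : -2 < y 0 + 2 * y 1 - (x 0 + 2 * x 1) := by exact_mod_cast k1.2
  have e2 : 2 * y 0 + y 1 - (2 * x 0 + x 1) < 2 := by exact_mod_cast k2.1
  have e2' : -2 < 2 * y 0 + y 1 - (2 * x 0 + x 1) := by exact_mod_cast k2.2
  funext j
  fin_cases j
  · show x 0 = y 0
    omega
  · show x 1 = y 1
    omega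

/-! ## The cells cover the plane off the integral level lines of the forms -/

/-- `3/2 ≤ √3`. -/
theorem three_halves_le_sqrt_three : (3 / 2 : ℝ) ≤ Real.sqrt 3 :=
  Real.le_sqrt_of_sq_le (by norm_num)

/-- `‖w − e‖²` in lattice coordinates, for a site `e`. -/
theorem norm_sq_sub_triEmbed (w : ℂ) (e : Site 2) :
    ‖w - triEmbed e‖ ^ 2 =
      (triX w - e 0) ^ 2 + (triX w - e 0) * (triY w - e 1) + (triY w - e 1) ^ 2 := by
  rw [norm_sq_eq_tri', triX_sub, triY_sub, triX_triEmbed, triY_triEmbed]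

/-- **Every point has a site whose three hex forms differ from its own by at most `1`**: a site `a`
minimising `‖z − a‖` (it exists: far sites are worse than the origin) is not improved by any of its
six neighbours `a ± 1, a ± ζ, a ± (1 − ζ)`, and `‖w ∓ e‖² − ‖w‖² = 1 ∓ μ_e(w)` for the unit
steps `e`. -/
theorem exists_site_forall_abs_hform_le_one (z : ℂ) :
    ∃ a : Site 2, ∀ i, |hform i (z - triEmbed a)| ≤ 1 := by
  -- minimise the distance to `z` over a large lattice hexagon
  set M : ℕ := ⌈3 * ‖z‖⌉₊ with hM
  obtain ⟨a, -, hmin⟩ :=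
    (triBall M).exists_min_image (fun b ↦ ‖z - triEmbed b‖) ⟨0, zero_mem_triBall M⟩
  have h0 : ‖z - triEmbed a‖ ≤ ‖z‖ := by simpa using hmin 0 (zero_mem_triBall M)
  -- `a` is a global minimiser
  have hglob : ∀ b : Site 2, ‖z - triEmbed a‖ ≤ ‖z - triEmbed b‖ := by
    intro b
    by_cases hb : b ∈ triBall M
    · exact hmin b hb
    · rw [mem_triBall_iff, not_le] at hb
      have hb' : (M : ℝ) + 1 ≤ triNorm b := by
        have : (M : ℤ) + 1 ≤ triNorm b := hb
        exact_mod_cast this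
      have hM' : 3 * ‖z‖ ≤ M := Nat.le_ceil _
      have ht : (0 : ℝ) ≤ triNorm b := by exact_mod_cast triNorm_nonneg b
      have h1 : 3 / 2 / 2 * (triNorm b : ℝ) ≤ ‖triEmbed b‖ :=
        le_trans (mul_le_mul_of_nonneg_right
          (div_le_div_of_nonneg_right three_halves_le_sqrt_three zero_le_two) ht)
          (mul_triNorm_le_norm_triEmbed b)
      have h2 : ‖triEmbed b‖ - ‖z‖ ≤ ‖z - triEmbed b‖ := by
        rw [norm_sub_rev z]; exact norm_sub_norm_le _ _
      linarith [norm_nonneg z]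
  -- compare with the six neighbours, in lattice coordinates
  have hsq : ∀ e : Site 2,
      triX (z - triEmbed a) ^ 2 + triX (z - triEmbed a) * triY (z - triEmbed a) +
          triY (z - triEmbed a) ^ 2 ≤
        (triX (z - triEmbed a) - e 0) ^ 2 +
          (triX (z - triEmbed a) - e 0) * (triY (z - triEmbed a) - e 1) +
            (triY (z - triEmbed a) - e 1) ^ 2 := by
    intro e
    have h' : ‖z - triEmbed a‖ ^ 2 ≤ ‖z - triEmbed (a + e)‖ ^ 2 :=
      pow_le_pow_left₀ (norm_nonneg _) (hglob (a + e)) 2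
    rwa [triEmbed_add, ← sub_sub, norm_sq_sub_triEmbed (z - triEmbed a) e,
      norm_sq_eq_tri' (z - triEmbed a)] at h'
  have h1 := hsq ![1, 0]
  have h2 := hsq ![-1, 0]
  have h3 := hsq ![0, 1]
  have h4 := hsq ![0, -1]
  have h5 := hsq ![1, -1]
  have h6 := hsq ![-1, 1]
  simp only [Matrix.cons_val_zero, Matrix.cons_val_one, Int.cast_one, Int.cast_zero,
    Int.cast_neg] at h1 h2 h3 h4 h5 h6
  refine ⟨a, fun i ↦ abs_le.2 ?_⟩
  fin_cases i
  · simp only [Fin.zero_eta, hform_zero]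
    constructor <;> nlinarith [h5, h6]
  · simp only [Fin.mk_one, hform_one]
    constructor <;> nlinarith [h3, h4]
  · simp only [Fin.reduceFinMk, hform_two]
    constructor <;> nlinarith [h1, h2]

/-- **A point on no integral level line of the three hex forms lies in some open cell.** -/
theorem exists_mem_hexCell_of_forall_ne_int {z : ℂ} (hz : ∀ (i : Fin 3) (n : ℤ), hform i z ≠ n) :
    ∃ a : Site 2, z ∈ 𝓗[a] := by
  obtain ⟨a, ha⟩ := exists_site_forall_abs_hform_le_one z
  refine ⟨a, fun i ↦ ?_⟩
  rw [triMeshPoint_one]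
  refine lt_of_le_of_ne (ha i) fun h ↦ ?_
  obtain ⟨m, hm⟩ := exists_int_hform_triEmbed i a
  rw [hform_sub', hm] at h
  rcases (abs_eq zero_le_one).1 h with h' | h'
  · exact hz i (m + 1) (by push_cast; linarith)
  · exact hz i (m - 1) (by push_cast; linarith)

/-- Each hex form is `a · re + b · im` with `a ≠ 0`. -/
theorem exists_hform_eq_re_im (i : Fin 3) :
    ∃ a b : ℝ, a ≠ 0 ∧ ∀ z : ℂ, hform i z = a * z.re + b * z.im := by
  fin_cases i
  · refine ⟨1, -(3 / Real.sqrt 3), one_ne_zero, fun z ↦ ?_⟩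
    simp only [Fin.zero_eta, hform_zero, triX, triY]; ring
  · refine ⟨1, 3 / Real.sqrt 3, one_ne_zero, fun z ↦ ?_⟩
    simp only [Fin.mk_one, hform_one, triX, triY]; ring
  · refine ⟨2, 0, two_ne_zero, fun z ↦ ?_⟩
    simp only [Fin.reduceFinMk, hform_two, triX, triY]; ring

/-- **A level line of a hex form is Lebesgue-null** (a translate of the kernel of a nonzero
real-linear functional on `ℂ`). -/
theorem volume_setOf_hform_eq (i : Fin 3) (c : ℝ) : volume {z : ℂ | hform i z = c} = 0 := by
  obtain ⟨a, b, ha, hab⟩ := exists_hform_eq_re_im i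
  let ℓ : ℂ →ₗ[ℝ] ℝ := a • Complex.reLm + b • Complex.imLm
  have hK : volume (LinearMap.ker ℓ : Set ℂ) = 0 := by
    refine Measure.addHaar_submodule volume _ fun htop ↦ ?_
    have h1 : (1 : ℂ) ∈ LinearMap.ker ℓ := htop ▸ Submodule.mem_top
    simp [ℓ] at h1
    exact ha h1
  have hset : {z : ℂ | hform i z = c} =
      (fun z : ℂ ↦ z + (-(c / a : ℝ) : ℂ)) ⁻¹' (LinearMap.ker ℓ : Set ℂ) := by
    ext z
    simp only [mem_setOf_eq, mem_preimage, SetLike.mem_coe, LinearMap.mem_ker, hab, ℓ,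
      LinearMap.add_apply, LinearMap.smul_apply, Complex.reLm_coe, Complex.imLm_coe, smul_eq_mul,
      Complex.add_re, Complex.add_im, Complex.neg_re, Complex.neg_im, Complex.ofReal_re,
      Complex.ofReal_im, neg_zero, add_zero]
    constructor
    · intro h
      field_simp
      linarith
    · intro h
      field_simp at h
      linarith
  rw [hset, measure_preimage_add_right]
  exact hK

/-- **The integral level lines of the three hex forms form a Lebesgue-null set.** -/
theorem volume_hformLines : volume {z : ℂ | ∃ (i : Fin 3) (n : ℤ), hform i z = n} = 0 := by
  have h : {z : ℂ | ∃ (i : Fin 3) (n : ℤ), hform i z = n} =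
      ⋃ i : Fin 3, ⋃ n : ℤ, {z : ℂ | hform i z = n} := by
    ext z; simp only [mem_setOf_eq, mem_iUnion]
  rw [h]
  exact measure_iUnion_null fun i ↦ measure_iUnion_null fun n ↦ volume_setOf_hform_eq i n

/-- **The open cells cover Lebesgue-almost all of `ℂ`.** -/
theorem ae_exists_mem_hexCell : ∀ᵐ z ∂(volume : Measure ℂ), ∃ a : Site 2, z ∈ 𝓗[a] := by
  rw [ae_iff]
  refine measure_mono_null (fun z hz ↦ ?_) volume_hformLines
  by_contra hcon
  simp only [mem_setOf_eq, not_exists] at hcon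
  exact hz (exists_mem_hexCell_of_forall_ne_int hcon)

/-! ## Charge sites -/

/-- **A cell meeting the closed disc `B̄(0, ρ)` has its site in `triBall ⌈2(ρ + 1)⌉₊`**
(`‖x‖ < ρ + 1` and `triNorm ≤ (2/√3)‖·‖`). -/
theorem mem_triBall_of_mem_hexCell_of_norm_le {z : ℂ} {x : Site 2} {ρ : ℝ} (hz : z ∈ 𝓗[x])
    (hρ : ‖z‖ ≤ ρ) : x ∈ triBall ⌈2 * (ρ + 1)⌉₊ := by
  rw [mem_triBall_iff]
  have h1 : ‖z - triEmbed x‖ < 1 := by simpa using norm_sub_lt_one_of_mem_hexCell hz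
  have h2 : ‖triEmbed x‖ < ρ + 1 := by
    have : ‖triEmbed x‖ - ‖z‖ ≤ ‖z - triEmbed x‖ := by
      rw [norm_sub_rev z]; exact norm_sub_norm_le _ _
    linarith
  have ht : (0 : ℝ) ≤ triNorm x := by exact_mod_cast triNorm_nonneg x
  have h3 : 3 / 2 / 2 * (triNorm x : ℝ) ≤ ‖triEmbed x‖ :=
    le_trans (mul_le_mul_of_nonneg_right
      (div_le_div_of_nonneg_right three_halves_le_sqrt_three zero_le_two) ht)
      (mul_triNorm_le_norm_triEmbed x)
  have h4 : (triNorm x : ℝ) < 2 * (ρ + 1) := by linarith [norm_nonneg z]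
  have h5 : (2 * (ρ + 1) : ℝ) ≤ (⌈2 * (ρ + 1)⌉₊ : ℕ) := Nat.le_ceil _
  have h6 : (triNorm x : ℝ) ≤ ((⌈2 * (ρ + 1)⌉₊ : ℕ) : ℝ) := (h4.trans_le h5).le
  exact_mod_cast h6

/-- **The charge sites have norm `≤ (2|R| + 3)/δ`**: for `0 < δ ≤ 1` and
`x ∈ triBall ⌈2(R/δ + 1)⌉₊`, `‖x‖ ≤ triNorm x ≤ ⌈2(R/δ + 1)⌉₊ ≤ (2|R| + 3)/δ`. -/
theorem norm_triMeshPoint_le_of_mem_triBall {R δ : ℝ} (hδ : 0 < δ) (hδ1 : δ ≤ 1) {x : Site 2}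
    (hx : x ∈ triBall ⌈2 * (R / δ + 1)⌉₊) : ‖triMeshPoint 1 x‖ ≤ (2 * |R| + 3) / δ := by
  rw [triMeshPoint_one]
  rw [mem_triBall_iff] at hx
  have h1 : ‖triEmbed x‖ ≤ triNorm x := norm_triEmbed_le_triNorm x
  have h2 : (triNorm x : ℝ) ≤ (⌈2 * (R / δ + 1)⌉₊ : ℕ) := by exact_mod_cast hx
  have h3 : ((⌈2 * (R / δ + 1)⌉₊ : ℕ) : ℝ) ≤ (2 * |R| + 3) / δ := by
    rcases le_or_gt (2 * (R / δ + 1)) 0 with h | h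
    · rw [Nat.ceil_eq_zero.2 h, Nat.cast_zero]
      positivity
    · have hc := Nat.ceil_lt_add_one h.le
      have hR : R ≤ |R| := le_abs_self R
      rw [le_div_iff₀ hδ]
      have hlt : (⌈2 * (R / δ + 1)⌉₊ : ℝ) * δ < (2 * (R / δ + 1) + 1) * δ :=
        mul_lt_mul_of_pos_right hc hδ
      have e : (2 * (R / δ + 1) + 1) * δ = 2 * R + 3 * δ := by
        field_simp
        ring
      nlinarith [abs_nonneg R]
  linarith

/-! ## Registered sub-goal -/

/-- **Sub-goal `cellBridge_hexCellsTiling` of stub `stub_cellBridge`: the open Voronoi hexagons of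
the unit lattice are open convex neighbourhoods of their sites inside the unit discs, pairwise
disjoint, and cover Lebesgue-almost all of `ℂ`.** -/
theorem cellBridge_hexCellsTiling :
    (∀ x : Site 2, IsOpen {z : ℂ | ∀ i : Fin 3, |hform i (z - triMeshPoint 1 x)| < 1} ∧
      Convex ℝ {z : ℂ | ∀ i : Fin 3, |hform i (z - triMeshPoint 1 x)| < 1} ∧
      triMeshPoint 1 x ∈ {z : ℂ | ∀ i : Fin 3, |hform i (z - triMeshPoint 1 x)| < 1} ∧
      {z : ℂ | ∀ i : Fin 3, |hform i (z - triMeshPoint 1 x)| < 1} ⊆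
        Metric.ball (triMeshPoint 1 x) 1) ∧
    (∀ x y : Site 2, x ≠ y → Disjoint {z : ℂ | ∀ i : Fin 3, |hform i (z - triMeshPoint 1 x)| < 1}
      {z : ℂ | ∀ i : Fin 3, |hform i (z - triMeshPoint 1 y)| < 1}) ∧
    (∀ᵐ z ∂(volume : Measure ℂ),
      ∃ a : Site 2, z ∈ {z : ℂ | ∀ i : Fin 3, |hform i (z - triMeshPoint 1 a)| < 1}) :=
  ⟨fun x ↦ ⟨isOpen_hexCell x, convex_hexCell x, triMeshPoint_mem_hexCell x, hexCell_subset_ball x⟩,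
    fun _ _ hxy ↦ disjoint_hexCell hxy, ae_exists_mem_hexCell⟩

end Summit.CriticalPhenomena.CardyFormulaZ2.Cruxes.MagicFormulaT.LineSketch

end
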